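import Mathlib.Analysis.Calculus.MeanValue
import Mathlib.Analysis.SpecialFunctions.ExpDeriv
import Mathlib.Topology.Instances.Matrix
import Mathlib.Topology.Sequences
import Mathlib.Order.Filter.AtTopBot.CountablyGenerated
import Mathlib.Algebra.BigOperators.Field
import HarnessLib

/-!
# Hamilton's Lipschitz calculus for minima of linear functions of an evolving matrix
(topic `Geometry/Riemannian`)

Support file of the decomposition of `Literature.Geometry.Riemannian.hamilton_chenZhu_pinching`
(`PinchingEstimates.lean`). Hamilton's ODE-invariance theorems (1986, §3 and Lemma 6.1; 1997,
§2) are proved for functions such as `a₁ = inf{A(x,x) : |x| = 1}` or `a₁ + a₂`, which are only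
Lipschitz along a solution `A(t)`: "the inf or sup is attained … as a result we see that `a₁` and
`c₁` are concave … Moreover we can compute their derivatives by Lemma 3.5" (1986, p. 167), the
derivative being understood as a one-sided Dini derivative (1986, §3: "we say `df/dt ≤ c` if the
lim sup of all forward difference quotients is `≤ c`"; Lemma 3.1: "If `f(a) ≤ 0` and `df/dt ≤ 0`
when `f ≥ 0` on `a ≤ t ≤ b`, then `f(b) ≤ 0`"; Lemma 3.5 = Danskin's formula for
`f(t) = sup{g(t, y) : y ∈ Y}`, `Y` compact).

We PROVE the form of this principle that the variational pinching sets need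
(`min_linComb_ge_of_deriv`): let `A : ℝ → M₃(ℝ)` be differentiable on `[a, b]` with derivative
`A'`, `K` a nonempty compact set of parameters and `Q(M, p) = Σ M_{kl} w_{kl}(p)` a linear
function of the matrix with continuous bounded coefficients (`HamiltonODE.linComb`; e.g.
`uᵀMu + vᵀMv`, `p = (u, v)`); put `φ(t) = min_{p ∈ K} Q(A(t), p)` (`HamiltonODE.minOver`). If,
at every `t ∈ [a, b)` at which `φ(t) > θ`, every minimiser `p` has `Q(A'(t), p) ≥ 0` (Hamilton's
differential inequality at the minimiser), and `φ(a) ≥ m > θ`, then `φ(b) ≥ m`. Proof: `φ` is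
continuous (`|φ(s) - φ(s')| ≤ C Σ|A(s) - A(s')|`), its lower right Dini derivative at `t` is
`≥ Q(A'(t), p*)` for some minimiser `p*` (Danskin, by compactness of `K` — Hamilton's Lemma 3.5,
`frequently_slope_minOver_lt_imp`), hence `≥ 0` when `φ(t) > θ`; the comparison principle
(Mathlib's `image_le_of_liminf_slope_right_lt_deriv_boundary'`, i.e. Hamilton's Lemma 3.1 with
the barrier `m - εe^{t-a}`) gives `φ ≥ m - εe^{t-a}` for all small `ε > 0`.

## References

* R. S. Hamilton, *Four-manifolds with positive curvature operator*, J. Differential Geom. 24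
  (1986), §3 (Lemma 3.1, Lemma 3.5, pp. 158–159) and §6, p. 167. [Hamilton1986]
* R. S. Hamilton, Comm. Anal. Geom. 5 (1997), §2.2, p. 14 ("the inequality is understood in the
  sense of lim sup … of forward difference quotients, since `x` and `y` may not be differentiable
  everywhere but only Lipschitz continuous (being the eigenvalues of a matrix)"). [Hamilton1997]
-/

noncomputable section

open Set Filter Topology
open scoped Matrix BigOperators

namespace Literature.Geometry.Riemannian

namespace HamiltonODE

variable {P : Type*}

/-! ### Linear functions of a matrix with parameter-dependent coefficients -/

/-- A linear function of a `3 × 3` matrix with parameter-dependent coefficients,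
`Q(M, p) = Σ_{k,l} M_{kl} w_{kl}(p)` (e.g. `uᵀMu + vᵀMv` for `p = (u, v)`,
`w_{kl}(p) = u_k u_l + v_k v_l`). [folklore] -/
def linComb (w : Fin 3 → Fin 3 → P → ℝ) (M : Matrix (Fin 3) (Fin 3) ℝ) (p : P) : ℝ :=
  ∑ k, ∑ l, M k l * w k l p

variable {w : Fin 3 → Fin 3 → P → ℝ}

/-- Linearity in the matrix: differences. [folklore] -/
theorem linComb_sub (M N : Matrix (Fin 3) (Fin 3) ℝ) (p : P) :
    linComb w (M - N) p = linComb w M p - linComb w N p := by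
  simp only [linComb, Matrix.sub_apply, sub_mul, Finset.sum_sub_distrib]

/-- Linearity in the matrix: scalars. [folklore] -/
theorem linComb_smul (c : ℝ) (M : Matrix (Fin 3) (Fin 3) ℝ) (p : P) :
    linComb w (c • M) p = c * linComb w M p := by
  simp only [linComb, Matrix.smul_apply, smul_eq_mul, mul_assoc, Finset.mul_sum]

/-- Bounded coefficients bound the function by the entries: `|Q(M, p)| ≤ C Σ|M_{kl}|`. [folklore] -/
theorem abs_linComb_le {C : ℝ} {p : P} (hwb : ∀ k l, |w k l p| ≤ C)
    (M : Matrix (Fin 3) (Fin 3) ℝ) : |linComb w M p| ≤ C * ∑ k, ∑ l, |M k l| := by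
  unfold linComb
  calc |∑ k, ∑ l, M k l * w k l p| ≤ ∑ k, ∑ l, |M k l * w k l p| :=
        (Finset.abs_sum_le_sum_abs _ _).trans (Finset.sum_le_sum fun k _ ↦
          Finset.abs_sum_le_sum_abs _ _)
    _ ≤ ∑ k, ∑ l, C * |M k l| := Finset.sum_le_sum fun k _ ↦ Finset.sum_le_sum fun l _ ↦ by
        rw [abs_mul, mul_comm]; exact mul_le_mul_of_nonneg_right (hwb k l) (abs_nonneg _)
    _ = C * ∑ k, ∑ l, |M k l| := by simp_rw [Finset.mul_sum]

/-- The difference of `Q` at two matrices is controlled by the entrywise distance. [folklore] -/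
theorem linComb_le_linComb_add {C : ℝ} {p : P} (hwb : ∀ k l, |w k l p| ≤ C)
    (M N : Matrix (Fin 3) (Fin 3) ℝ) :
    linComb w M p ≤ linComb w N p + C * ∑ k, ∑ l, |M k l - N k l| := by
  have h := (le_abs_self _).trans (abs_linComb_le hwb (M - N))
  rw [linComb_sub] at h
  simp only [Matrix.sub_apply] at h
  linarith

variable [TopologicalSpace P]

/-- `Q` is jointly continuous in `(M, p)` for continuous coefficients. [folklore] -/
theorem continuous_linComb (hw : ∀ k l, Continuous (w k l)) :
    Continuous fun q : Matrix (Fin 3) (Fin 3) ℝ × P ↦ linComb w q.1 q.2 := by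
  unfold linComb
  refine continuous_finsetSum _ fun k _ ↦ continuous_finsetSum _ fun l _ ↦ ?_
  exact (continuous_fst.matrix_elem k l).mul ((hw k l).comp continuous_snd)

/-- `Q(M, ·)` is continuous for continuous coefficients. [folklore] -/
theorem continuous_linComb_right (hw : ∀ k l, Continuous (w k l)) (M : Matrix (Fin 3) (Fin 3) ℝ) :
    Continuous (linComb w M) :=
  (continuous_linComb hw).comp (Continuous.prodMk_right M)

/-! ### The minimum over a compact parameter set -/

/-- `φ(M) = min_{p ∈ K} Q(M, p)` (an infimum, attained when `K` is compact and nonempty; e.g.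
`a₁ + a₂ = min {uᵀAu + vᵀAv}` over orthonormal pairs, Hamilton 1986, p. 167: "the inf or sup is
attained"). [cite: Hamilton1986, §6, p. 167] -/
def minOver (w : Fin 3 → Fin 3 → P → ℝ) (K : Set P) (M : Matrix (Fin 3) (Fin 3) ℝ) : ℝ :=
  sInf (linComb w M '' K)

section Compact

variable {K : Set P} (hK : IsCompact K) (hKne : K.Nonempty) (hw : ∀ k l, Continuous (w k l))
include hK hKne hw

/-- The minimum is attained. [folklore] -/
theorem exists_minOver_eq (M : Matrix (Fin 3) (Fin 3) ℝ) :
    ∃ p ∈ K, minOver w K M = linComb w M p ∧ ∀ q ∈ K, linComb w M p ≤ linComb w M q :=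
  hK.exists_sInf_image_eq_and_le hKne (continuous_linComb_right hw M).continuousOn

/-- The minimum is a lower bound. [folklore] -/
theorem minOver_le (M : Matrix (Fin 3) (Fin 3) ℝ) {p : P} (hp : p ∈ K) :
    minOver w K M ≤ linComb w M p := by
  obtain ⟨q, -, hq, hmin⟩ := exists_minOver_eq hK hKne hw M
  rw [hq]; exact hmin p hp

/-- `m ≤ min` iff `m` is a lower bound on `K`. [folklore] -/
theorem le_minOver_iff (M : Matrix (Fin 3) (Fin 3) ℝ) (m : ℝ) :
    m ≤ minOver w K M ↔ ∀ p ∈ K, m ≤ linComb w M p := by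
  refine ⟨fun h p hp ↦ h.trans (minOver_le hK hKne hw M hp), fun h ↦ ?_⟩
  obtain ⟨q, hqK, hq, -⟩ := exists_minOver_eq hK hKne hw M
  rw [hq]; exact h q hqK

/-- **The minimum is Lipschitz in the matrix** (entrywise): `|φ(M) - φ(N)| ≤ C Σ|M_{kl} - N_{kl}|`
for coefficients bounded by `C` on `K`. [folklore] -/
theorem minOver_sub_le {C : ℝ} (hwb : ∀ p ∈ K, ∀ k l, |w k l p| ≤ C)
    (M N : Matrix (Fin 3) (Fin 3) ℝ) :
    minOver w K M ≤ minOver w K N + C * ∑ k, ∑ l, |M k l - N k l| := by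
  obtain ⟨q, hqK, hq, -⟩ := exists_minOver_eq hK hKne hw N
  rw [hq]
  exact (minOver_le hK hKne hw M hqK).trans (linComb_le_linComb_add (hwb q hqK) M N)

omit hK hKne hw in
/-- Symmetry of the entrywise distance. [folklore] -/
theorem entryDist_comm (M N : Matrix (Fin 3) (Fin 3) ℝ) :
    ∑ k, ∑ l, |M k l - N k l| = ∑ k, ∑ l, |N k l - M k l| :=
  Finset.sum_congr rfl fun _ _ ↦ Finset.sum_congr rfl fun _ _ ↦ abs_sub_comm _ _

/-! ### Along a matrix curve: continuity and Dini derivatives of the minimum -/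

variable {A : ℝ → Matrix (Fin 3) (Fin 3) ℝ} {C : ℝ} (hwb : ∀ p ∈ K, ∀ k l, |w k l p| ≤ C)
include hwb

/-- The minimum along a curve is continuous wherever the entries are. [folklore] -/
theorem continuousWithinAt_minOver {S : Set ℝ} {s : ℝ}
    (hA : ∀ k l, ContinuousWithinAt (fun t ↦ A t k l) S s) :
    ContinuousWithinAt (fun t ↦ minOver w K (A t)) S s := by
  have hD : Tendsto (fun t ↦ C * ∑ k, ∑ l, |A t k l - A s k l|) (𝓝[S] s) (𝓝 0) := by
    have : Tendsto (fun t ↦ C * ∑ k, ∑ l, |A t k l - A s k l|) (𝓝[S] s)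
        (𝓝 (C * ∑ k : Fin 3, ∑ l : Fin 3, |A s k l - A s k l|)) :=
      (tendsto_finsetSum _ fun k _ ↦ tendsto_finsetSum _ fun l _ ↦
        ((hA k l).sub tendsto_const_nhds).abs).const_mul C
    simpa using this
  rw [ContinuousWithinAt, tendsto_iff_norm_sub_tendsto_zero]
  refine squeeze_zero (fun t ↦ norm_nonneg _) (fun t ↦ ?_) hD
  rw [Real.norm_eq_abs, abs_sub_le_iff]
  have h2 := minOver_sub_le hK hKne hw hwb (A s) (A t)
  rw [entryDist_comm] at h2
  exact ⟨by linarith [minOver_sub_le hK hKne hw hwb (A t) (A s)], by linarith⟩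

/-- Forward slopes of the minimum are bounded below by the entrywise slopes. [folklore] -/
theorem neg_le_slope_minOver {x z : ℝ} (hxz : x < z) :
    -(C * ∑ k, ∑ l, |slope (fun t ↦ A t k l) x z|) ≤ slope (fun t ↦ minOver w K (A t)) x z := by
  have hzx : 0 < z - x := sub_pos.2 hxz
  have h := minOver_sub_le hK hKne hw hwb (A x) (A z)
  have e : C * ∑ k, ∑ l, |slope (fun t ↦ A t k l) x z| =
      (C * ∑ k, ∑ l, |A x k l - A z k l|) / (z - x) := by
    rw [mul_div_assoc, Finset.sum_div]
    congr 1
    refine Finset.sum_congr rfl fun k _ ↦ ?_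
    rw [Finset.sum_div]
    refine Finset.sum_congr rfl fun l _ ↦ ?_
    rw [slope_def_field, abs_div, abs_of_pos hzx, abs_sub_comm]
  rw [e, slope_def_field, ← neg_div]
  exact div_le_div_of_nonneg_right (by linarith) hzx.le


/-- A crude bound: the lower right Dini derivative of the minimum is finite wherever the entries
are differentiable (it is `≥ -C Σ|A'_{kl}|`). [folklore] -/
theorem eventually_lt_slope_minOver {x : ℝ} {Ax' : Matrix (Fin 3) (Fin 3) ℝ}
    (hAx : ∀ k l, HasDerivAt (fun t ↦ A t k l) (Ax' k l) x) {r : ℝ}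
    (hr : r < -(C * ∑ k, ∑ l, |Ax' k l| + 1)) :
    ∀ᶠ z in 𝓝[>] x, r < slope (fun t ↦ minOver w K (A t)) x z := by
  have hto : Tendsto (fun z ↦ C * ∑ k, ∑ l, |slope (fun t ↦ A t k l) x z|) (𝓝[>] x)
      (𝓝 (C * ∑ k, ∑ l, |Ax' k l|)) :=
    (tendsto_finsetSum _ fun k _ ↦ tendsto_finsetSum _ fun l _ ↦
      ((hasDerivAt_iff_tendsto_slope.1 (hAx k l)).mono_left
        (nhdsWithin_mono _ fun z hz ↦ ne_of_gt hz)).abs).const_mul C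
  have hev := hto.eventually (gt_mem_nhds (show C * ∑ k, ∑ l, |Ax' k l| <
    C * ∑ k, ∑ l, |Ax' k l| + 1 by linarith))
  filter_upwards [hev, self_mem_nhdsWithin] with z hz hzx
  exact lt_of_lt_of_le (by linarith) (neg_le_slope_minOver hK hKne hw hwb hzx)

/-- **Danskin's inequality at a point where the minimisers satisfy Hamilton's differential
inequality** (Hamilton 1986, Lemma 3.5): if the entries of `A` are differentiable at `x` with
derivative `A'ₓ` and every minimiser `p` of `Q(A(x), ·)` on the compact `K` has `Q(A'ₓ, p) ≥ 0`,
then the lower right Dini derivative of `φ = min_K Q(A(·), ·)` at `x` is `≥ 0`: every `r < 0` is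
eventually below the forward slopes. (By contradiction: slopes `≤ r` along `zₙ ↓ x` give
minimisers `pₙ` at `zₙ` with `Q((A(zₙ) - A(x))/(zₙ - x), pₙ) ≤ r`; a subsequence of `pₙ`
converges to a minimiser `p*` at `x`, and in the limit `Q(A'ₓ, p*) ≤ r < 0`.)
[cite: Hamilton1986, §3, Lemma 3.5 (p. 159)] -/
theorem eventually_lt_slope_minOver_of_sign [FirstCountableTopology P] {x : ℝ}
    {Ax' : Matrix (Fin 3) (Fin 3) ℝ} (hAx : ∀ k l, HasDerivAt (fun t ↦ A t k l) (Ax' k l) x)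
    (hsign : ∀ p ∈ K, IsMinOn (linComb w (A x)) K p → 0 ≤ linComb w Ax' p) {r : ℝ}
    (hr : r < 0) : ∀ᶠ z in 𝓝[>] x, r < slope (fun t ↦ minOver w K (A t)) x z := by
  by_contra hcon
  have hfreq : ∃ᶠ z in 𝓝[>] x, slope (fun t ↦ minOver w K (A t)) x z ≤ r ∧ x < z := by
    have h1 : ∃ᶠ z in 𝓝[>] x, slope (fun t ↦ minOver w K (A t)) x z ≤ r := by
      simpa [not_eventually, not_lt] using hcon
    exact h1.and_eventually self_mem_nhdsWithin
  obtain ⟨zs, hzs, hzsP⟩ := exists_seq_forall_of_frequently hfreq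
  -- minimisers at the points `zs n` and a convergent subsequence
  choose pm hpmK hpmeq hpmmin using fun n ↦ exists_minOver_eq hK hKne hw (A (zs n))
  obtain ⟨pstar, hpK, ψ, hψ, hpψ⟩ := hK.tendsto_subseq hpmK
  have hzψ : Tendsto (zs ∘ ψ) atTop (𝓝[>] x) := hzs.comp hψ.tendsto_atTop
  have hzψx : Tendsto (zs ∘ ψ) atTop (𝓝 x) := hzψ.mono_right nhdsWithin_le_nhds
  -- the matrices of entrywise slopes converge to `Ax'`
  set Sl : ℕ → Matrix (Fin 3) (Fin 3) ℝ := fun n ↦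
    Matrix.of fun k l ↦ slope (fun t ↦ A t k l) x (zs (ψ n)) with hSl
  have hSlto : Tendsto Sl atTop (𝓝 Ax') :=
    tendsto_pi_nhds.2 fun k ↦ tendsto_pi_nhds.2 fun l ↦
      ((hasDerivAt_iff_tendsto_slope.1 (hAx k l)).mono_left
        (nhdsWithin_mono _ fun z hz ↦ ne_of_gt hz)).comp hzψ
  -- `Q(Sl n, p_{ψ n}) ≤ r`
  have hQle : ∀ n, linComb w (Sl n) (pm (ψ n)) ≤ r := by
    intro n
    obtain ⟨hsl, hxz⟩ := hzsP (ψ n)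
    have hzx : 0 < zs (ψ n) - x := sub_pos.2 hxz
    have h1 : minOver w K (A (zs (ψ n))) - minOver w K (A x) ≤ r * (zs (ψ n) - x) := by
      rw [slope_def_field, div_le_iff₀ hzx] at hsl; linarith
    have h2 := minOver_le hK hKne hw (A x) (hpmK (ψ n))
    have h3 := hpmeq (ψ n)
    have e : linComb w (Sl n) (pm (ψ n)) =
        (linComb w (A (zs (ψ n))) (pm (ψ n)) - linComb w (A x) (pm (ψ n))) / (zs (ψ n) - x) := by
      have hS : Sl n = (zs (ψ n) - x)⁻¹ • (A (zs (ψ n)) - A x) := by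
        ext k l
        simp [hSl, slope_def_field, div_eq_inv_mul, Matrix.sub_apply]
      rw [hS, linComb_smul, linComb_sub, inv_mul_eq_div]
    rw [e, div_le_iff₀ hzx]
    linarith
  -- pass to the limit: `Q(Ax', p*) ≤ r < 0`
  have hpψ' : Tendsto (fun n ↦ pm (ψ n)) atTop (𝓝 pstar) := hpψ
  have hpair : Tendsto (fun n ↦ (Sl n, pm (ψ n))) atTop (𝓝 (Ax', pstar)) :=
    hSlto.prodMk_nhds hpψ'
  have hlim := ((continuous_linComb hw).tendsto (Ax', pstar)).comp hpair
  simp only [Function.comp_def] at hlim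
  have hneg : linComb w Ax' pstar ≤ r := le_of_tendsto' hlim hQle
  -- `p*` is a minimiser at `x`
  have hmin' : IsMinOn (linComb w (A x)) K pstar := by
    refine isMinOn_iff.2 fun q hq ↦ ?_
    have hcontA : ∀ k l, ContinuousAt (fun t ↦ A t k l) x := fun k l ↦ (hAx k l).continuousAt
    have hDn : Tendsto (fun n ↦ C * ∑ k, ∑ l, |A (zs (ψ n)) k l - A x k l|) atTop (𝓝 0) := by
      have : Tendsto (fun n ↦ C * ∑ k, ∑ l, |A (zs (ψ n)) k l - A x k l|) atTop
          (𝓝 (C * ∑ k : Fin 3, ∑ l : Fin 3, |A x k l - A x k l|)) :=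
        (tendsto_finsetSum _ fun k _ ↦ tendsto_finsetSum _ fun l _ ↦
          (((hcontA k l).tendsto.comp hzψx).sub tendsto_const_nhds).abs).const_mul C
      simpa using this
    have hleft : Tendsto (fun n ↦ linComb w (A x) (pm (ψ n))) atTop
        (𝓝 (linComb w (A x) pstar)) :=
      ((continuous_linComb_right hw (A x)).tendsto pstar).comp hpψ'
    have hright : Tendsto (fun n ↦ linComb w (A x) q +
        2 * (C * ∑ k, ∑ l, |A (zs (ψ n)) k l - A x k l|)) atTop
        (𝓝 (linComb w (A x) q + 2 * 0)) :=
      tendsto_const_nhds.add (hDn.const_mul 2)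
    rw [mul_zero, add_zero] at hright
    refine le_of_tendsto_of_tendsto' hleft hright fun n ↦ ?_
    have h1 := linComb_le_linComb_add (hwb _ (hpmK (ψ n))) (A x) (A (zs (ψ n)))
    have h2 := hpmmin (ψ n) q hq
    have h3 := linComb_le_linComb_add (hwb q hq) (A (zs (ψ n))) (A x)
    rw [entryDist_comm] at h1
    linarith
  linarith [hsign pstar hpK hmin']

/-- **Minima of linear functions of a differentiable matrix curve obey their differential
inequality** (Hamilton 1986, §3, Lemmas 3.1 and 3.5, as used for `a₁`, `a₁ + a₂`, … in §6 and in
Hamilton 1997, §2). Let `A` be a curve of `3 × 3` matrices, differentiable on `[a, b]` with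
derivative `A'`; `K` a nonempty compact set in a first countable space of parameters;
`Q(M, p) = Σ M_{kl} w_{kl}(p)` with continuous coefficients bounded on `K`; `θ < m`. Suppose that
at every `t ∈ [a, b)` with `min_K Q(A(t), ·) > θ` every minimiser `p ∈ K` satisfies
`Q(A'(t), p) ≥ 0`. If `min_K Q(A(a), ·) ≥ m`, then `min_K Q(A(b), ·) ≥ m`.
[cite: Hamilton1986, §3, Lemma 3.1 and Lemma 3.5 (pp. 158–159)] -/
theorem minOver_ge_of_deriv [FirstCountableTopology P] {A' : ℝ → Matrix (Fin 3) (Fin 3) ℝ}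
    {a b : ℝ} (hab : a ≤ b) (hA : ∀ s ∈ Icc a b, ∀ k l, HasDerivAt (fun t ↦ A t k l) (A' s k l) s)
    {θ m : ℝ} (hθm : θ < m)
    (hsign : ∀ s ∈ Ico a b, θ < minOver w K (A s) →
      ∀ p ∈ K, IsMinOn (linComb w (A s)) K p → 0 ≤ linComb w (A' s) p)
    (h0 : m ≤ minOver w K (A a)) : m ≤ minOver w K (A b) := by
  classical
  set φ : ℝ → ℝ := fun t ↦ minOver w K (A t) with hφ
  have hC : 0 ≤ C := by
    obtain ⟨p, hp⟩ := hKne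
    exact (abs_nonneg _).trans (hwb p hp 0 0)
  have hφcont : ContinuousOn φ (Icc a b) := fun s hs ↦
    continuousWithinAt_minOver hK hKne hw hwb fun k l ↦ (hA s hs k l).continuousAt.continuousWithinAt
  -- comparison with the barrier `B t = -m + ε e^{t-a}`
  have hmain : ∀ ε : ℝ, 0 < ε → ε * Real.exp (b - a) < m - θ →
      m - ε * Real.exp (b - a) ≤ φ b := by
    intro ε hε hεθ
    set f' : ℝ → ℝ := fun t ↦ if θ < φ t then 0 else C * ∑ k, ∑ l, |A' t k l| + 1 with hf'
    have hBd : ∀ t, HasDerivAt (fun t ↦ -m + ε * Real.exp (t - a)) (ε * Real.exp (t - a)) t :=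
      fun t ↦ by simpa using (((hasDerivAt_id t).sub_const a).exp.const_mul ε).const_add (-m)
    have hslope_neg : ∀ t z, slope (fun t ↦ -φ t) t z = -slope φ t z := fun t z ↦ by
      simp only [slope_def_field, neg_sub_neg, ← neg_sub (φ z) (φ t), neg_div]
    have key := image_le_of_liminf_slope_right_lt_deriv_boundary' (f := fun t ↦ -φ t) (f' := f')
      (a := a) (b := b) hφcont.neg ?hf' (B := fun t ↦ -m + ε * Real.exp (t - a))
      (B' := fun t ↦ ε * Real.exp (t - a)) ?ha (fun t _ ↦ (hBd t).continuousAt.continuousWithinAt)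
      (fun t _ ↦ (hBd t).hasDerivWithinAt) ?bound (right_mem_Icc.2 hab)
    · linarith
    case ha =>
      simp only [sub_self, Real.exp_zero, mul_one]
      linarith
    case hf' =>
      intro t ht r hr
      by_cases hgood : θ < φ t
      · simp only [hf', hgood, if_true] at hr
        have h := eventually_lt_slope_minOver_of_sign hK hKne hw hwb (hA t (Ico_subset_Icc_self ht))
          (hsign t ht hgood) (neg_lt_zero.2 hr)
        refine (h.mono fun z hz ↦ ?_).frequently
        rw [hslope_neg]; linarith
      · simp only [hf', hgood, if_false] at hr
        have h := eventually_lt_slope_minOver hK hKne hw hwb (hA t (Ico_subset_Icc_self ht))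
          (r := -r) (by linarith)
        refine (h.mono fun z hz ↦ ?_).frequently
        rw [hslope_neg]; linarith
    case bound =>
      intro t ht hft
      have hexp : Real.exp (t - a) ≤ Real.exp (b - a) := Real.exp_le_exp.2 (by linarith [ht.2])
      have hgood : θ < φ t := by
        have hφt : φ t = m - ε * Real.exp (t - a) := by linarith
        rw [hφt]; nlinarith
      simp only [hf', hgood, if_true]
      positivity
  -- let `ε → 0`
  refine le_of_forall_pos_lt_add fun δ hδ ↦ ?_
  have hE : 0 < Real.exp (b - a) := Real.exp_pos _
  set ε : ℝ := min (δ / 2) ((m - θ) / 2) / Real.exp (b - a) with hε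
  have hεpos : 0 < ε := by positivity
  have hεe : ε * Real.exp (b - a) = min (δ / 2) ((m - θ) / 2) := by
    rw [hε, div_mul_cancel₀ _ hE.ne']
  have h1 := hmain ε hεpos (by rw [hεe]; linarith [min_le_right (δ / 2) ((m - θ) / 2)])
  rw [hεe] at h1
  linarith [min_le_left (δ / 2) ((m - θ) / 2)]

end Compact

end HamiltonODE

end Literature.Geometry.Riemannian

end
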